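import Summits.BirchSwinnertonDyer.BirchSwinnertonDyer.Theorems.ByReductionTypeAtTwoSupersingularFlatBlindLocalTransversalityApZero
import Literature.NumberTheory.EllipticCurves.Sprung2012.SharpFlatSelmer
import HarnessLib

/-!
# Route `ByReductionTypeAtTwo` (rung K4), crux `SupersingularRankZeroAtTwo` (item stmt-BirchSwinnertonDyer-19097):
# CDF local transversality at `a₂ = 0` IN THE CURRENCY OF SPRUNG'S Def. 7.9 — the divisibility clause of the ♭ local condition
# `E^♭ = Ann(Ker Col♭)` (tree `Sprung2012.sharpFlatLocalKummerOverOfEmb`) FAILS on the Kummer line of a `ψ₂`-vector beyond a bounded exponent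
# (seat `bsd-2adic-ss-1`, GEN 18, LEAD attack (L2), part 4)

HONEST FRAMING (cell `bsd-2adic`): THEOREMS ONLY; no definition, no named fact, no `sorry`, no instance; nothing booked; BSD is not proved by
any of this. PARTITION: X5@2 good-ss r₀, `a₂ = 0` sub-row × p = 2 — types-the-object-of; closes none. bears_on: K4 (19097).

## What is proved
Sprung's ♭ local condition (Def. 7.9, transcribed as `sharpFlatLocalKummerOverOfEmb W 2 H ι M (colemanKer … .flat)`) admits a Kummer class
`x ⊗ 2^{−j}` (witness `(Q, j)`, `2^j·Q = x ∈ M = E(ℚ_{∞,v}·ℚ_v)`) only if **`2^j ∣ z(x)` for every `z ∈ Ker Col♭`**.  For `W` good-ss at `2` with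
`a₂ = 0`, cyclotomic `κ`, `v ∋ 2`, any (L)(TR)-system `c`, and a `ψ₂`-vector `y ∈ E(ℚ_{1,v})` with `y ∉ 2^k·E(ℚ_{1,v})`, part 2
(`exists_mem_colemanKer_flat_not_dvd_apply_of_frobeniusTrace_eq_zero`, p801290) supplies `z ∈ Ker Col♭` with `2^{k+1} ∤ z(y)`; hence:
* `OddBlindLocal.exponent_le_of_forall_mem_colemanKer_flat_dvd` — if `2^j·Q = y` and the divisibility clause holds for `(Q, j)` then **`j ≤ k`**:
  the ♭ condition contains `y ⊗ 2^{−j}` only for `j ≤ k` — its intersection with the Kummer line `ℤ₂·y ⊗ ℚ₂/ℤ₂` of the twist is killed by `2^k`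
  (the LOCAL half of CDF `FlatBlindControlFiniteAtTwo` at `a₂ = 0`, in the vocabulary the line's `conjSharpFlatSelmerInfty … .flat` is built from).

References: [Sprung2012] Def. 7.9, Def. 7.11 (p. 1503); [Kobayashi2003] Prop. 8.12 ii).
-/

set_option autoImplicit false
set_option linter.dupNamespace false

noncomputable section

open scoped Classical NumberField

namespace Summit.BirchSwinnertonDyer.BirchSwinnertonDyer.Theorems

namespace OddBlindLocal

open NumberField IsDedekindDomain Literature.NumberTheory.EllipticCurves Literature.NumberTheory.GaloisRepresentations
  ZpExtension Literature.NumberTheory.EllipticCurves.Kobayashi2003 Literature.NumberTheory.EllipticCurves.Sprung2017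
  Literature.NumberTheory.EllipticCurves.Sprung2012 Literature.NumberTheory.EllipticCurves.Rank1Residual

variable (W : WeierstrassCurve ℚ) [W.IsElliptic] [W.IsGloballyMinimal]

/-- ★★ **The divisibility clause of Sprung's `E^♭` (Def. 7.9) fails on the Kummer line of a `ψ₂`-vector beyond exponent `k`, at `a₂ = 0`.**
Binders as in part 2; conclusion: for every `Q ∈ E(ℚ̄_v)` and `j` with `2^j·Q = y` (so `(Q, j)` represents the Kummer class `y ⊗ 2^{−j}`), if
`2^j ∣ z(2^j·Q)` for every `z ∈ Ker Col♭` — the clause `∀ z ∈ 𝒦, p^k ∣ z ⟨p^k • Q, hQ⟩` of `sharpFlatLocalKummerOverOfEmb … (colemanKer … .flat)` — then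
`j ≤ k`. [cite: Sprung2012, Def. 7.9 and Def. 7.11 (p. 1503)] [cite: Kobayashi2003, Prop. 8.12 ii) (p. 17)] -/
theorem exponent_le_of_forall_mem_colemanKer_flat_dvd (hss : GoodSS W 2) (ha : W.frobeniusTrace 2 = 0)
    {κ : ZpExtension ℚ 2} (hκ : κ.IsCyclotomic) (v : HeightOneSpectrum (𝓞 ℚ)) (hv : (2 : 𝓞 ℚ) ∈ v.asIdeal)
    {g : Field.absoluteGaloisGroup (v.adicCompletion ℚ)}
    (hg : κ.IsTopGenerator (resGalOfEmb (closureEmb (K := ℚ) (v.adicCompletion ℚ)) g))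
    {c : ℕ → localPoints W (v.adicCompletion ℚ)}
    (hc : ∀ n, c n ∈ localLayerPointsOfEmb κ (closureEmb (K := ℚ) (v.adicCompletion ℚ)) W n)
    (htr : ∀ n, 1 ≤ n → localTraceOfEmb κ (closureEmb (K := ℚ) (v.adicCompletion ℚ)) W n (n + 1)
      (c (n + 1)) = W.frobeniusTrace 2 • c n - c (n - 1))
    {y : localPoints W (v.adicCompletion ℚ)}
    (hy : y ∈ localLayerPointsOfEmb κ (closureEmb (K := ℚ) (v.adicCompletion ℚ)) W 1) (hgy : g • y = -y)
    {k : ℕ} (hndiv : ∀ w ∈ localLayerPointsOfEmb κ (closureEmb (K := ℚ) (v.adicCompletion ℚ)) W 1, 2 ^ k • w ≠ y)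
    {Q : localPoints W (v.adicCompletion ℚ)} {j : ℕ}
    (hQ : 2 ^ j • Q ∈ localTowerPointsOfEmb κ (closureEmb (K := ℚ) (v.adicCompletion ℚ)) W) (hQy : 2 ^ j • Q = y)
    (hdiv : ∀ z ∈ colemanKer κ (closureEmb (K := ℚ) (v.adicCompletion ℚ)) W (W.frobeniusTrace 2) g c .flat,
      (2 : ℤ_[2]) ^ j ∣ z ⟨2 ^ j • Q, hQ⟩) :
    j ≤ k := by
  obtain ⟨z, hz, hzy⟩ :=
    exists_mem_colemanKer_flat_not_dvd_apply_of_frobeniusTrace_eq_zero W hss ha hκ v hv hg hc htr hy hgy hndiv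
  have hjy : (2 : ℤ_[2]) ^ j ∣
      z ⟨y, localLayerPointsOfEmb_le_localTowerPointsOfEmb κ (closureEmb (K := ℚ) (v.adicCompletion ℚ)) W 1 hy⟩ := by
    have h := hdiv z hz
    have e : (⟨2 ^ j • Q, hQ⟩ : localTowerPointsOfEmb κ (closureEmb (K := ℚ) (v.adicCompletion ℚ)) W) =
        ⟨y, localLayerPointsOfEmb_le_localTowerPointsOfEmb κ (closureEmb (K := ℚ) (v.adicCompletion ℚ)) W 1 hy⟩ :=
      Subtype.ext hQy
    rwa [e] at h
  by_contra hjk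
  exact hzy ((pow_dvd_pow (2 : ℤ_[2]) (by omega : k + 1 ≤ j)).trans hjy)

/-- **Equivalently: NO witness `(Q, j)` with `j > k` and `2^j·Q = y` satisfies the ♭ divisibility clause** — the Kummer classes
`y ⊗ 2^{−j}`, `j > k`, lie OUTSIDE `E^♭_{∞,v}` (its defining clause already fails, whatever the cocycle data).
[cite: Sprung2012, Def. 7.9 (p. 1503)] -/
theorem not_forall_mem_colemanKer_flat_dvd_of_lt (hss : GoodSS W 2) (ha : W.frobeniusTrace 2 = 0)
    {κ : ZpExtension ℚ 2} (hκ : κ.IsCyclotomic) (v : HeightOneSpectrum (𝓞 ℚ)) (hv : (2 : 𝓞 ℚ) ∈ v.asIdeal)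
    {g : Field.absoluteGaloisGroup (v.adicCompletion ℚ)}
    (hg : κ.IsTopGenerator (resGalOfEmb (closureEmb (K := ℚ) (v.adicCompletion ℚ)) g))
    {c : ℕ → localPoints W (v.adicCompletion ℚ)}
    (hc : ∀ n, c n ∈ localLayerPointsOfEmb κ (closureEmb (K := ℚ) (v.adicCompletion ℚ)) W n)
    (htr : ∀ n, 1 ≤ n → localTraceOfEmb κ (closureEmb (K := ℚ) (v.adicCompletion ℚ)) W n (n + 1)
      (c (n + 1)) = W.frobeniusTrace 2 • c n - c (n - 1))
    {y : localPoints W (v.adicCompletion ℚ)}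
    (hy : y ∈ localLayerPointsOfEmb κ (closureEmb (K := ℚ) (v.adicCompletion ℚ)) W 1) (hgy : g • y = -y)
    {k : ℕ} (hndiv : ∀ w ∈ localLayerPointsOfEmb κ (closureEmb (K := ℚ) (v.adicCompletion ℚ)) W 1, 2 ^ k • w ≠ y)
    {Q : localPoints W (v.adicCompletion ℚ)} {j : ℕ} (hjk : k < j)
    (hQ : 2 ^ j • Q ∈ localTowerPointsOfEmb κ (closureEmb (K := ℚ) (v.adicCompletion ℚ)) W) (hQy : 2 ^ j • Q = y) :
    ¬ ∀ z ∈ colemanKer κ (closureEmb (K := ℚ) (v.adicCompletion ℚ)) W (W.frobeniusTrace 2) g c .flat,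
      (2 : ℤ_[2]) ^ j ∣ z ⟨2 ^ j • Q, hQ⟩ :=
  fun hdiv ↦ absurd (exponent_le_of_forall_mem_colemanKer_flat_dvd W hss ha hκ v hv hg hc htr hy hgy hndiv hQ hQy hdiv)
    (by omega)

end OddBlindLocal

end Summit.BirchSwinnertonDyer.BirchSwinnertonDyer.Theorems

end
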